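import Literature.Geometry.Riemannian.CurvatureDecomposition
import HarnessLib

/-!
# Hamilton's blocks of a curvature tensor modified by a Kulkarni–Nomizu term `k ⊙ g`
(topic `Geometry/Riemannian`)

A brick of the surgery step of Chen–Zhu's Thm. 5.6
(`Literature.Geometry.Riemannian.chenZhu_surgicalStep_admissibleRestart`; Chen–Zhu 2006,
Lemma 5.3 = Hamilton 1997, Thm. D3.1), namely the pointwise linear algebra behind Hamilton's
Lemma D2.1 / Thm. D2.6 (Comm. Anal. Geom. 5 (1997), §4.2, pp. 50–57: under `g̃ = e^{-2f} g`,
"up to the common factor `e^{2f}` the Weyl tensor is unchanged, while the scalar curvature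
increases … all the eigenvalues of `A` and `C` will increase … subtracting two copies of `D₄D₄f`
from each principal strain of the `B` matrix"). By Besse 1987, Thm. 1.159 (b)
(`OpensChart.curvatureForm_conformalRepr`, `ConformalIsotropicCurvature.lean`) the covariant
curvature tensor of a conformal metric `g' = c g` is `Rm' = c (Rm − k ⊙ g)` for a symmetric
2-tensor `k` (there `k = H − θ⊗θ + ½|θ|² g`). This file computes, for ANY two pairs
`(g, cov)`, `(g', cov')` whose curvature tensors at a point `x` are so related
(hypothesis `hconf`, with an arbitrary function `k`), Hamilton's blocks (`blockA`, `blockB`,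
`blockC` of `CurvatureDecomposition.lean`) of `(g', cov')` in a `g_x`-orthonormal 4-frame `e`
in terms of those of `(g, cov)` and the frame components `β_ab = k(e_a, e_b)`:

* `blockA_of_curvatureForm_eq_conformal`, `blockC_…`, `blockB_…` — the general formulas
  `A' = c (A − K_A(β))`, `C' = c (C − K_C(β))`, `B' = c (B − K_B(β))` with explicit `3 × 3`
  matrices `K_A, K_B, K_C` linear in `β` (for the tree's unnormalised bases
  `φ₁ = e₁∧e₂ + e₃∧e₄, …` of `Λ²₊` and `ψᵢ` of `Λ²₋`);
* `blockA_of_curvatureForm_eq_conformal_of_symm`, `blockC_…_of_symm`, `blockB_…_of_symm` —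
  for symmetric `β` (the conformal case): **`A' = c (A − (tr β) 1)`, `C' = c (C − (tr β) 1)`**
  — the Kulkarni–Nomizu term is pure trace on `Λ²₊` and on `Λ²₋`, so ALL eigenvalues of `A`
  and of `C` are shifted by the same amount `−tr β` (Hamilton: "`ãᵢ ≈ aᵢ + 2D₄D₄f` for
  `1 ≤ i ≤ 3`") — and **`B' = c (B − K_B(β))`** with
  `K_B(β) = [[β₀₀+β₁₁−β₂₂−β₃₃, 2(β₁₂−β₀₃), 2(β₀₂+β₁₃)], [2(β₁₂+β₀₃), β₀₀+β₂₂−β₁₁−β₃₃,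
  2(β₂₃−β₀₁)], [2(β₁₃−β₀₂), 2(β₀₁+β₂₃), β₀₀+β₃₃−β₁₁−β₂₂]]`, which depends only on the
  traceless part of `β` (the traceless Ricci part `Λ²₊ → Λ²₋`);
* `blockA_smul_frame`, `blockB_smul_frame`, `blockC_smul_frame` — homogeneity
  `A(t e) = t⁴ A(e)` (each block entry is a sum of values of the 4-linear `Rm`), used to pass
  from the `g`-orthonormal frame `e` to the `g'`-orthonormal frame `c^{-1/2} e`.

Everything here is proved (finite sums over Hamilton's bases); no definitions, no named facts.

## References

* R. S. Hamilton, *Four-manifolds with positive isotropic curvature*, Comm. Anal. Geom. 5 (1997)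
  1–92: §1.2 (the blocks, pp. 4–6), §4.2 (Lemma 2.1, Cor. 2.2, Lemma 2.3, Thm. 2.6, pp. 50–57).
  [Hamilton1997]
* A. L. Besse, *Einstein manifolds*, Springer 1987, Thm. 1.159 (b) and 1.116–1.117
  (`h ⊙ g` lies in the Ricci/scalar summands of the curvature decomposition). [Besse1987]
-/

noncomputable section

open scoped Manifold ContDiff Matrix

namespace Literature.Geometry.Riemannian

open Lorentzian Lorentzian.PseudoRiemannianMetric

variable {E : Type*} [NormedAddCommGroup E] [NormedSpace ℝ E] {H : Type*} [TopologicalSpace H]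
  {I : ModelWithCorners ℝ E H} {M : Type*} [TopologicalSpace M] [ChartedSpace H M]
  [IsManifold I ∞ M] {n : ℕ∞ω}
  (g g' : PseudoRiemannianMetric I n E (TangentSpace I : M → Type _))
  (cov cov' : CovariantDerivative I E (TangentSpace I : M → Type _)) (x : M)

/-! ### Homogeneity of the blocks in the frame -/

/-- `A(t e) = t⁴ A(e)`. [folklore] -/
theorem blockA_smul_frame (t : ℝ) (e : Fin 4 → TangentSpace I x) :
    g.blockA cov x (fun i ↦ t • e i) = t ^ 4 • g.blockA cov x e := by
  ext i j
  fin_cases i <;> fin_cases j <;>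
    simp [blockA, pairingCurvature, selfDualPairs, Fin.sum_univ_two, bivectorCurvature,
      curvatureForm, map_smul] <;> ring

/-- `B(t e) = t⁴ B(e)`. [folklore] -/
theorem blockB_smul_frame (t : ℝ) (e : Fin 4 → TangentSpace I x) :
    g.blockB cov x (fun i ↦ t • e i) = t ^ 4 • g.blockB cov x e := by
  ext i j
  fin_cases i <;> fin_cases j <;>
    simp [blockB, pairingCurvature, selfDualPairs, antiSelfDualPairs, Fin.sum_univ_two,
      bivectorCurvature, curvatureForm, map_smul] <;> ring

/-- `C(t e) = t⁴ C(e)`. [folklore] -/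
theorem blockC_smul_frame (t : ℝ) (e : Fin 4 → TangentSpace I x) :
    g.blockC cov x (fun i ↦ t • e i) = t ^ 4 • g.blockC cov x e := by
  ext i j
  fin_cases i <;> fin_cases j <;>
    simp [blockC, pairingCurvature, antiSelfDualPairs, Fin.sum_univ_two, bivectorCurvature,
      curvatureForm, map_smul] <;> ring

/-! ### The blocks of `c (Rm − k ⊙ g)` -/

section KN

variable {g g' cov cov' x} {c : ℝ} {k : TangentSpace I x → TangentSpace I x → ℝ}
  (hconf : ∀ X Y Z W : TangentSpace I x, g'.curvatureForm cov' x X Y Z W =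
    c * (g.curvatureForm cov x X Y Z W
      - (k X W * g.val x Y Z + k Y Z * g.val x X W - k X Z * g.val x Y W - k Y W * g.val x X Z)))
  {e : Fin 4 → TangentSpace I x} (he : g.IsOrthonormalFrame x e)
  {β : Matrix (Fin 4) (Fin 4) ℝ} (hβ : ∀ a b, β a b = k (e a) (e b))

include hconf he hβ

/-- **The block `A` of `c (Rm − k ⊙ g)` in a `g`-orthonormal frame**: `A' = c (A − K_A(β))`,
`K_A(β)` the displayed matrix (diagonal `tr β`, antisymmetric off-diagonal part, which vanishes
for symmetric `β`). [cite: Hamilton1997, §4.2, Lemma 2.1 and p. 51] [cite: Besse1987, Thm. 1.159 (b)] -/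
theorem blockA_of_curvatureForm_eq_conformal :
    g'.blockA cov' x e = c • (g.blockA cov x e -
      !![β 0 0 + β 1 1 + β 2 2 + β 3 3, β 0 3 + β 1 2 - β 2 1 - β 3 0, -β 0 2 + β 1 3 + β 2 0 - β 3 1;
         -β 0 3 - β 1 2 + β 2 1 + β 3 0, β 0 0 + β 1 1 + β 2 2 + β 3 3, β 0 1 - β 1 0 + β 2 3 - β 3 2;
         β 0 2 - β 1 3 - β 2 0 + β 3 1, -β 0 1 + β 1 0 - β 2 3 + β 3 2, β 0 0 + β 1 1 + β 2 2 + β 3 3]) := by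
  have hk : ∀ a b, k (e a) (e b) = β a b := fun a b ↦ (hβ a b).symm
  have hd : ∀ i, g.val x (e i) (e i) = 1 := he.1
  have ho : ∀ i j, i ≠ j → g.val x (e i) (e j) = 0 := he.2
  ext i j
  simp only [Matrix.smul_apply, Matrix.sub_apply, smul_eq_mul, blockA, Matrix.of_apply]
  fin_cases i <;> fin_cases j <;>
    simp [pairingCurvature, selfDualPairs, Fin.sum_univ_two, bivectorCurvature, hconf, hk,
      hd, ho 0 1 (by decide), ho 0 2 (by decide), ho 0 3 (by decide), ho 1 0 (by decide),
      ho 1 2 (by decide), ho 1 3 (by decide), ho 2 0 (by decide), ho 2 1 (by decide),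
      ho 2 3 (by decide), ho 3 0 (by decide), ho 3 1 (by decide), ho 3 2 (by decide)] <;> ring

/-- **The block `C` of `c (Rm − k ⊙ g)`**: `C' = c (C − K_C(β))`.
[cite: Hamilton1997, §4.2, Lemma 2.1 and p. 51] [cite: Besse1987, Thm. 1.159 (b)] -/
theorem blockC_of_curvatureForm_eq_conformal :
    g'.blockC cov' x e = c • (g.blockC cov x e -
      !![β 0 0 + β 1 1 + β 2 2 + β 3 3, -β 0 3 + β 1 2 - β 2 1 + β 3 0, β 0 2 + β 1 3 - β 2 0 - β 3 1;
         β 0 3 - β 1 2 + β 2 1 - β 3 0, β 0 0 + β 1 1 + β 2 2 + β 3 3, -β 0 1 + β 1 0 + β 2 3 - β 3 2;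
         -β 0 2 - β 1 3 + β 2 0 + β 3 1, β 0 1 - β 1 0 - β 2 3 + β 3 2, β 0 0 + β 1 1 + β 2 2 + β 3 3]) := by
  have hk : ∀ a b, k (e a) (e b) = β a b := fun a b ↦ (hβ a b).symm
  have hd : ∀ i, g.val x (e i) (e i) = 1 := he.1
  have ho : ∀ i j, i ≠ j → g.val x (e i) (e j) = 0 := he.2
  ext i j
  simp only [Matrix.smul_apply, Matrix.sub_apply, smul_eq_mul, blockC, Matrix.of_apply]
  fin_cases i <;> fin_cases j <;>
    simp [pairingCurvature, antiSelfDualPairs, Fin.sum_univ_two, bivectorCurvature, hconf,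
      hk, hd, ho 0 1 (by decide), ho 0 2 (by decide), ho 0 3 (by decide), ho 1 0 (by decide),
      ho 1 2 (by decide), ho 1 3 (by decide), ho 2 0 (by decide), ho 2 1 (by decide),
      ho 2 3 (by decide), ho 3 0 (by decide), ho 3 1 (by decide), ho 3 2 (by decide)] <;> ring

/-- **The block `B` of `c (Rm − k ⊙ g)`**: `B' = c (B − K_B(β))`, `K_B(β)` the displayed matrix
(it kills `β = 1`: the Kulkarni–Nomizu term of a pure trace has no `Λ²₊ → Λ²₋` part).
[cite: Hamilton1997, §4.2, Lemma 2.3 and pp. 52–53] [cite: Besse1987, Thm. 1.159 (b)] -/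
theorem blockB_of_curvatureForm_eq_conformal :
    g'.blockB cov' x e = c • (g.blockB cov x e -
      !![β 0 0 + β 1 1 - β 2 2 - β 3 3, -β 0 3 + β 1 2 + β 2 1 - β 3 0, β 0 2 + β 1 3 + β 2 0 + β 3 1;
         β 0 3 + β 1 2 + β 2 1 + β 3 0, β 0 0 - β 1 1 + β 2 2 - β 3 3, -β 0 1 - β 1 0 + β 2 3 + β 3 2;
         -β 0 2 + β 1 3 - β 2 0 + β 3 1, β 0 1 + β 1 0 + β 2 3 + β 3 2, β 0 0 - β 1 1 - β 2 2 + β 3 3]) := by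
  have hk : ∀ a b, k (e a) (e b) = β a b := fun a b ↦ (hβ a b).symm
  have hd : ∀ i, g.val x (e i) (e i) = 1 := he.1
  have ho : ∀ i j, i ≠ j → g.val x (e i) (e j) = 0 := he.2
  ext i j
  simp only [Matrix.smul_apply, Matrix.sub_apply, smul_eq_mul, blockB, Matrix.of_apply]
  fin_cases i <;> fin_cases j <;>
    simp [pairingCurvature, selfDualPairs, antiSelfDualPairs, Fin.sum_univ_two,
      bivectorCurvature, hconf, hk, hd, ho 0 1 (by decide), ho 0 2 (by decide), ho 0 3 (by decide),
      ho 1 0 (by decide), ho 1 2 (by decide), ho 1 3 (by decide), ho 2 0 (by decide),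
      ho 2 1 (by decide), ho 2 3 (by decide), ho 3 0 (by decide), ho 3 1 (by decide),
      ho 3 2 (by decide)] <;> ring

omit hβ in
/-- **Symmetric case, block `A`: `A' = c (A − (tr β) 1)`** — all eigenvalues of `A` are shifted by
`−tr β` and scaled by `c` (Hamilton: "`R` is the common trace part of the `A` and `C` matrices,
while `W₊` and `W₋` are the trace-free parts … therefore all the eigenvalues of `A` and `C` will
increase [by the same amount]"). [cite: Hamilton1997, §4.2, p. 51] [cite: Besse1987, Thm. 1.159 (b)] -/
theorem blockA_of_curvatureForm_eq_conformal_of_symm (hβ : ∀ a b, β a b = k (e a) (e b))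
    (hsymm : β.IsSymm) :
    g'.blockA cov' x e = c • (g.blockA cov x e - β.trace • (1 : Matrix (Fin 3) (Fin 3) ℝ)) := by
  have hs : ∀ a b, β b a = β a b := fun a b ↦ by
    simpa [Matrix.transpose_apply] using congrFun (congrFun hsymm a) b
  have hk : ∀ a b, k (e a) (e b) = β a b := fun a b ↦ (hβ a b).symm
  have hd : ∀ i, g.val x (e i) (e i) = 1 := he.1
  have ho : ∀ i j, i ≠ j → g.val x (e i) (e j) = 0 := he.2
  ext i j
  simp only [Matrix.smul_apply, Matrix.sub_apply, smul_eq_mul, blockA, Matrix.of_apply,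
    Matrix.trace, Fin.sum_univ_four, Matrix.diag_apply]
  fin_cases i <;> fin_cases j <;>
    simp [pairingCurvature, selfDualPairs, Fin.sum_univ_two, bivectorCurvature, hconf, hk,
      hd, ho 0 1 (by decide), ho 0 2 (by decide), ho 0 3 (by decide), ho 1 0 (by decide),
      ho 1 2 (by decide), ho 1 3 (by decide), ho 2 0 (by decide), ho 2 1 (by decide),
      ho 2 3 (by decide), ho 3 0 (by decide), ho 3 1 (by decide), ho 3 2 (by decide),
      hs 0 1, hs 0 2, hs 0 3, hs 1 2, hs 1 3, hs 2 3] <;> ring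

omit hβ in
/-- **Symmetric case, block `C`: `C' = c (C − (tr β) 1)`.**
[cite: Hamilton1997, §4.2, p. 51] [cite: Besse1987, Thm. 1.159 (b)] -/
theorem blockC_of_curvatureForm_eq_conformal_of_symm (hβ : ∀ a b, β a b = k (e a) (e b))
    (hsymm : β.IsSymm) :
    g'.blockC cov' x e = c • (g.blockC cov x e - β.trace • (1 : Matrix (Fin 3) (Fin 3) ℝ)) := by
  have hs : ∀ a b, β b a = β a b := fun a b ↦ by
    simpa [Matrix.transpose_apply] using congrFun (congrFun hsymm a) b
  have hk : ∀ a b, k (e a) (e b) = β a b := fun a b ↦ (hβ a b).symm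
  have hd : ∀ i, g.val x (e i) (e i) = 1 := he.1
  have ho : ∀ i j, i ≠ j → g.val x (e i) (e j) = 0 := he.2
  ext i j
  simp only [Matrix.smul_apply, Matrix.sub_apply, smul_eq_mul, blockC, Matrix.of_apply,
    Matrix.trace, Fin.sum_univ_four, Matrix.diag_apply]
  fin_cases i <;> fin_cases j <;>
    simp [pairingCurvature, antiSelfDualPairs, Fin.sum_univ_two, bivectorCurvature, hconf, hk,
      hd, ho 0 1 (by decide), ho 0 2 (by decide), ho 0 3 (by decide), ho 1 0 (by decide),
      ho 1 2 (by decide), ho 1 3 (by decide), ho 2 0 (by decide), ho 2 1 (by decide),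
      ho 2 3 (by decide), ho 3 0 (by decide), ho 3 1 (by decide), ho 3 2 (by decide),
      hs 0 1, hs 0 2, hs 0 3, hs 1 2, hs 1 3, hs 2 3] <;> ring

omit hβ in
/-- **Symmetric case, block `B`: `B' = c (B − K_B(β))`** with
`K_B(β) = [[β₀₀+β₁₁−β₂₂−β₃₃, 2(β₁₂−β₀₃), 2(β₀₂+β₁₃)], [2(β₁₂+β₀₃), β₀₀+β₂₂−β₁₁−β₃₃, 2(β₂₃−β₀₁)],
[2(β₁₃−β₀₂), 2(β₀₁+β₂₃), β₀₀+β₃₃−β₁₁−β₂₂]]` — for `β` dominated by `β₃₃` (the Hessian of `f`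
along the neck) this is `≈ β₃₃ · diag(−1, −1, 1)`, opposite to the `B`-block `b · diag(1, 1, −1)`
of a round neck with axis `e₄`: "this has the effect of subtracting … from each principal strain
of the `B` matrix". [cite: Hamilton1997, §4.2, Lemma 2.3 and pp. 52–53] [cite: Besse1987, Thm. 1.159 (b)] -/
theorem blockB_of_curvatureForm_eq_conformal_of_symm (hβ : ∀ a b, β a b = k (e a) (e b))
    (hsymm : β.IsSymm) :
    g'.blockB cov' x e = c • (g.blockB cov x e -
      !![β 0 0 + β 1 1 - β 2 2 - β 3 3, 2 * (β 1 2 - β 0 3), 2 * (β 0 2 + β 1 3);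
         2 * (β 1 2 + β 0 3), β 0 0 + β 2 2 - β 1 1 - β 3 3, 2 * (β 2 3 - β 0 1);
         2 * (β 1 3 - β 0 2), 2 * (β 0 1 + β 2 3), β 0 0 + β 3 3 - β 1 1 - β 2 2]) := by
  have hs : ∀ a b, β b a = β a b := fun a b ↦ by
    simpa [Matrix.transpose_apply] using congrFun (congrFun hsymm a) b
  have hk : ∀ a b, k (e a) (e b) = β a b := fun a b ↦ (hβ a b).symm
  have hd : ∀ i, g.val x (e i) (e i) = 1 := he.1
  have ho : ∀ i j, i ≠ j → g.val x (e i) (e j) = 0 := he.2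
  ext i j
  simp only [Matrix.smul_apply, Matrix.sub_apply, smul_eq_mul, blockB, Matrix.of_apply]
  fin_cases i <;> fin_cases j <;>
    simp [pairingCurvature, selfDualPairs, antiSelfDualPairs, Fin.sum_univ_two,
      bivectorCurvature, hconf, hk, hd, ho 0 1 (by decide), ho 0 2 (by decide), ho 0 3 (by decide),
      ho 1 0 (by decide), ho 1 2 (by decide), ho 1 3 (by decide), ho 2 0 (by decide),
      ho 2 1 (by decide), ho 2 3 (by decide), ho 3 0 (by decide), ho 3 1 (by decide),
      ho 3 2 (by decide), hs 0 1, hs 0 2, hs 0 3, hs 1 2, hs 1 3, hs 2 3] <;> ring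

end KN

end Literature.Geometry.Riemannian

end
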